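import Summits.QuantumFields.YangMills.Theorems.BalabanUVNodesN19DefectGasManyClasses
import Summits.QuantumFields.YangMills.Theorems.BalabanUVNodesN19RekeyingCalculus

/-!
# BalabanUVNodes ∕ node N19 (NE7) — THE DECIMATED IDEAL DEFECT GAS: the first inhabitant of node U5d's FIBRED presentation (`T4MatchingAssembly` §3: run B's OWN terms on its
# OWN finer index, summed into run A's classes along a genuine CLASS MAP) — run B lives on the `m`-fold refined lattice, the class map is the BLOCK SHADOW, run B's class values
# are again an ideal defect gas with the DECIMATED activity `(a′ + g′)^m − g′^m` and vacuum `g′^m`, and the two runs match modulo constants (`Spine.NE7.Core`, `HybridNE7`) exactly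
# to the extent that run A's relative activity is the block-RG image of run B's

Cell `pub-ymgap` (HUMAN RULING D-0062 Track A ∕ D-0149 width seats), WIDTH SEAT `pub-ymgap-dag-n19-w1` (node n19 = NE7, seat 1 of 3), generation g2, INTENT-4 (this seat's g0 HANDOFF
named it as the located successor «the KEYED (fibred) defect gas»).  Route `Summits/QuantumFields/YangMills/Theses/BalabanUVNodes.lean`, key item K3⁷ `SpineGivenEndpointR13SepCoPH`
(stmt-QuantumFields-20544); filed `--kind proof --supports … --as helper`.  COUNT-NEUTRAL.  THEOREMS ONLY (0 `def`, 0 `sorry`).  ADDITIVE — imports this seat's g0 `…N19DefectGasManyClasses`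
(p587708: `core_defectGas`, `hybridNE7_defectGas`; through it `Spine/NE7/Targets` (`Core`), `T4MatchingAssembly` (`HybridNE7`, `classVal`, `sum_classVal`)), this seat's g2
`…N19RekeyingCalculus` (p593255: `hybridNE7_image_foldBad`, for §4 only) and Mathlib (`Finset.prod_univ_sum`, `Fintype.piFinset`, `Fin.sum_pow_mul_eq_add_pow`) — CITED BY NAME;
modifies nothing.

WHY.  Node U5 compares run A (`K` steps from spacing `L^{−K}`) with run B (`K + 1` steps from `L^{−K−1}`): run B's terms carry EXTRA FINEST-SCALE DATA and are summed into run A's classes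
along a class map (node U5d, `T4MatchingAssembly.classVal` ∕ `T4HybridMatching.fiberSum`; at the ₁₃ record the block-down `truncSeq` fibre, dag-n20-w3 `core_twoRunKeyed_iff_termwise`).
Every `Core` ∕ `HybridNE7` inhabitant in the tree so far has BOTH runs on the SAME index (King towers `Unit`∕`Bool`; the ideal defect gas p587708 on `Λ.powerset`; p593255's calculus is
about SHAPES).  This file supplies the first inhabitant in which the class map does real work, in the simplest honest model: run A = an ideal defect gas on the coarse lattice `α`
(class = defect set `D`, term `(Π_{x∈D} a_K(x)e^{t·w_d(x)})·(g_K e^{t·w₀})^{|α∖D|}`, p587708); run B = an ideal defect gas on the REFINED lattice `α × Fin m` (a configuration = a choice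
`f x ⊆ Fin m` of defective fine sites in every block `x`, activity `a′_K(x)` per fine defect, vacuum `g′_K` per fine site, the observable read PER BLOCK: `e^{t·w_d(x)}` on a defective
block, `e^{t·w₀}` on an empty one); class map = the BLOCK SHADOW `f ↦ {x : f x ≠ ∅}`.  Then (§1–§2, a `piFinset` computation) run B's CLASS VALUE at `D` is
`(Π_{x∈D} ((a′_K(x) + g′_K)^m − g′_K^m)·e^{t·w_d(x)})·(g′_K^m·e^{t·w₀})^{|α∖D|}` — an ideal defect gas on `α` again, with the DECIMATED letters `â = (a′ + g′)^m − g′^m`, `ĝ = g′^m`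
(the block-spin RG map of the relative activity `z ↦ (1 + z)^m − 1`).  Hence (§3) p587708 applies VERBATIM to the pair (run A, class values of run B): `Core` with the extensive
constant `|α|·(m·log g′_K − log g_K)` and the per-defect remainder `ε_K ≥ |log â_K(x) − log a_K(x) − (log ĝ_K − log g_K)|` — i.e. NE7 holds for the decimated pair EXACTLY TO THE
EXTENT THAT RUN A's RELATIVE ACTIVITY `a∕g` IS THE RG IMAGE `(1 + a′∕g′)^m − 1` OF RUN B's, uniformly per defect (`core_decimatedGas_exact`: equality ⇒ `δ = 0`); and `HybridNE7` with
NE7b PRODUCED for the size cut `|D| > n` (`hybridNE7_decimatedGas`).  The caricature of node U5a's synchronisation requirement: the two runs must be driven by the same RG.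
* §1 [folklore] `filter_shadow_eq_piFinset` (the fine configurations with shadow `D` are a `Fintype.piFinset`: non-empty fibres on `D`, empty off `D`) · ★ `sum_filter_shadow_eq_prod`
  (for ANY block weight `w`: `Σ_{shadow f = D} Π_x w x (f x) = (Π_{x∈D} Σ_{F≠∅} w x F)·Π_{x∉D} w x ∅` — `Finset.prod_univ_sum`).
* §2 [folklore] `sum_blockWeight_erase_empty` (binomial: `Σ_{F≠∅} a′^{|F|} g′^{m−|F|}·E = ((a′+g′)^m − g′^m)·E`, `Fin.sum_pow_mul_eq_add_pow`) · ★★ `classVal_decimated` (THE CLOSED FORM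
  of run B's class values along the shadow) · `sum_classVal_decimated` (run B's fine partition function = Σ_D of its class values: the E2 dictionary at the fine level,
  `T4MatchingAssembly.sum_classVal`).
* §4 [folklore ∘ p593255 BY NAME] ★ `hybridNE7_defectGas_blocked` — THE CALCULUS FIRES ON A MANY-CLASS DATUM: p587708's ideal-gas `HybridNE7` (bad classes `|D| > n`, weight `W`)
  re-keyed along ANY block map `b : α → β` of the coarse lattice (class map `D ↦ D.image b`, which merges bad with good) by `hybridNE7_image_foldBad` — a `HybridNE7` at the BLOCKED
  key with every class good, `W ↦ 0`, and NON-ZERO shells = the re-keyed large-defect-set terms (`Wsh := W`); the A2 instance of p593255 §5 with both quantifiers busy.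
* §3 [folklore ∘ p587708 BY NAME] ★★ `core_decimatedGas` (`Core l₀ vol (univ.powerset) {|D| > n} A (classVal univ shadow b) (n·ε∕vol)`, constant `|α|·(log ĝ − log g)`) ·
  `core_decimatedGas_exact` (run A's letters = the decimated letters up to a COMMON factor ⇒ `Core` with `δ = 0`) · ★★ `hybridNE7_decimatedGas` (`HybridNE7` with the size-cut
  weight `(1 + p_K e^{2l₀B₀})^{|α|} − 1` PRODUCED, shells zero, in the fibred presentation `B := classVal …`).

HONEST FRAMING.  A finite TOY (ideal gases; product weights; decimation = independent blocks) — NOT King's model, NOT Bałaban's NE7 ∕ NE7b (NOT PRINTED as two-run statements for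
d = 4; NODE O's objects), nothing of Bałaban's instantiated or asserted; no estimate of the programme is proved.  Count-neutral; N19 NOT discharged (0∕1); K3⁷ NOT claimed; counts
UNMOVED (typed 28∕28 · discharged 5∕27).  Everything PROVED (0 `sorry`, 0 named facts, standard axioms).  One finite four-torus programme at fixed ε — NOT ℝ⁴, NOT OS, NOT a mass
gap, NOT the Clay problem (R4 closes the conditional finite-𝕋⁴ rung `BalabanLadder.UV` only).
-/

noncomputable section

namespace Summit.QuantumFields.YangMills.BalabanUVNodes.N19DecimatedDefectGas

open Finset
open Summit.QuantumFields.BalabanUV.T4Continuum.Spine.NE7 (Core)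
open Literature.MathematicalPhysics.QuantumFieldTheory.Balaban1983to89.T4WeightBudget (RelWeightBound)
open Literature.MathematicalPhysics.QuantumFieldTheory.Balaban1983to89.T4MatchingAssembly (HybridNE7 classVal sum_classVal)
open Summit.QuantumFields.YangMills.BalabanUVNodes.N19DefectGasManyClasses (core_defectGas hybridNE7_defectGas)

variable {α : Type*} [Fintype α] [DecidableEq α] {m : ℕ}

/-! ## §1 Fine configurations with a given block shadow form a `piFinset`; summing a product weight over them factorises -/

/-- The fine configurations `f : α → Finset (Fin m)` whose BLOCK SHADOW `{x : f x ≠ ∅}` is `D` are exactly the `Fintype.piFinset` «a non-empty fine set on every block of `D`, the empty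
one off `D`». [folklore] -/
theorem filter_shadow_eq_piFinset (D : Finset α) :
    (Finset.univ : Finset (α → Finset (Fin m))).filter (fun f => Finset.univ.filter (fun x => (f x).Nonempty) = D)
      = Fintype.piFinset fun x => if x ∈ D then (Finset.univ : Finset (Finset (Fin m))).erase ∅ else {∅} := by
  ext f
  simp only [Finset.mem_filter, Finset.mem_univ, true_and, Fintype.mem_piFinset]
  constructor
  · intro h x
    split_ifs with hx
    · rw [← h] at hx
      exact Finset.mem_erase.mpr ⟨Finset.nonempty_iff_ne_empty.mp (Finset.mem_filter.mp hx).2, Finset.mem_univ _⟩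
    · have hne : ¬ (f x).Nonempty := fun hne => hx (h ▸ Finset.mem_filter.mpr ⟨Finset.mem_univ _, hne⟩)
      exact Finset.mem_singleton.mpr (Finset.not_nonempty_iff_eq_empty.mp hne)
  · intro h
    ext x
    simp only [Finset.mem_filter, Finset.mem_univ, true_and]
    have hx := h x
    constructor
    · intro hne
      by_contra hxD
      rw [if_neg hxD, Finset.mem_singleton] at hx
      exact hne.ne_empty hx
    · intro hxD
      rw [if_pos hxD, Finset.mem_erase] at hx
      exact Finset.nonempty_iff_ne_empty.mpr hx.1

/-- **★ SUMMING A PRODUCT WEIGHT OVER THE CONFIGURATIONS WITH SHADOW `D` FACTORISES OVER THE BLOCKS** [folklore]: for ANY block weight `w`,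
`Σ_{shadow f = D} Π_x w x (f x) = (Π_{x∈D} Σ_{F ≠ ∅} w x F)·(Π_{x∉D} w x ∅)` (`Finset.prod_univ_sum` over the `piFinset` of `filter_shadow_eq_piFinset`). -/
theorem sum_filter_shadow_eq_prod (w : α → Finset (Fin m) → ℝ) (D : Finset α) :
    ∑ f ∈ (Finset.univ : Finset (α → Finset (Fin m))).filter (fun f => Finset.univ.filter (fun x => (f x).Nonempty) = D), ∏ x, w x (f x)
      = (∏ x ∈ D, ∑ F ∈ (Finset.univ : Finset (Finset (Fin m))).erase ∅, w x F) * ∏ x ∈ Finset.univ \ D, w x ∅ := by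
  rw [filter_shadow_eq_piFinset, ← Finset.prod_univ_sum]
  have hsplit : ∀ x, (∑ F ∈ (if x ∈ D then (Finset.univ : Finset (Finset (Fin m))).erase ∅ else {∅}), w x F)
      = if x ∈ D then ∑ F ∈ (Finset.univ : Finset (Finset (Fin m))).erase ∅, w x F else w x ∅ := fun x => by
    split_ifs <;> simp
  simp_rw [hsplit]
  rw [Finset.prod_ite]
  congr 1
  · exact Finset.prod_congr (Finset.filter_univ_mem D) fun _ _ => rfl
  · refine Finset.prod_congr ?_ fun _ _ => rfl
    ext x
    simp

/-! ## §2 The block weight of the refined gas: binomial sum and the closed form of run B's class values -/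

/-- **BINOMIAL OVER ONE BLOCK** [folklore]: `Σ_{∅ ≠ F ⊆ Fin m} a′^{|F|}·g′^{m−|F|}·E = ((a′ + g′)^m − g′^m)·E` (`Fin.sum_pow_mul_eq_add_pow` minus the empty term). -/
theorem sum_blockWeight_erase_empty (A G E V : ℝ) :
    ∑ F ∈ (Finset.univ : Finset (Finset (Fin m))).erase ∅, (if F = ∅ then V else A ^ F.card * G ^ (m - F.card) * E) = ((A + G) ^ m - G ^ m) * E := by
  have h1 : ∑ F ∈ (Finset.univ : Finset (Finset (Fin m))).erase ∅, (if F = ∅ then V else A ^ F.card * G ^ (m - F.card) * E)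
      = ∑ F ∈ (Finset.univ : Finset (Finset (Fin m))).erase ∅, A ^ F.card * G ^ (m - F.card) * E :=
    Finset.sum_congr rfl fun F hF => by rw [if_neg (Finset.ne_of_mem_erase hF)]
  rw [h1, Finset.sum_erase_eq_sub (Finset.mem_univ _), ← Finset.sum_mul, Fin.sum_pow_mul_eq_add_pow, Finset.card_empty, pow_zero,
    Nat.sub_zero, one_mul]
  ring

section ClassValues

variable (a' : ℕ → α → ℝ) (g' : ℕ → ℝ) (w0 : ℝ) (wd : α → ℝ)

/-- **★★ THE CLOSED FORM OF RUN B's CLASS VALUES ALONG THE BLOCK SHADOW** [folklore].  Run B = the ideal defect gas on the refined lattice `α × Fin m` (configuration `f`, term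
`Π_x [if f x = ∅ then g′^m·e^{t·w₀} else a′(x)^{|f x|}·g′^{m−|f x|}·e^{t·w_d(x)}]`), summed into run A's classes (defect sets `D ⊆ α`) along the shadow: the class value at `D` is the
COARSE defect-gas term with the DECIMATED letters `â(x) = (a′(x) + g′)^m − g′^m`, `ĝ = g′^m`. -/
theorem classVal_decimated (K : ℕ) (t : ℝ) (D : Finset α) :
    classVal (fun _ => (Finset.univ : Finset (α → Finset (Fin m)))) (fun _ f => Finset.univ.filter fun x => (f x).Nonempty)
        (fun K t f => ∏ x, if f x = ∅ then g' K ^ m * Real.exp (t * w0) else a' K x ^ (f x).card * g' K ^ (m - (f x).card) * Real.exp (t * wd x)) K t D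
      = (∏ x ∈ D, ((a' K x + g' K) ^ m - g' K ^ m) * Real.exp (t * wd x)) * ∏ _x ∈ Finset.univ \ D, g' K ^ m * Real.exp (t * w0) := by
  show ∑ f ∈ (Finset.univ : Finset (α → Finset (Fin m))).filter (fun f => Finset.univ.filter (fun x => (f x).Nonempty) = D), _ = _
  rw [sum_filter_shadow_eq_prod (fun x F => if F = ∅ then g' K ^ m * Real.exp (t * w0) else a' K x ^ F.card * g' K ^ (m - F.card) * Real.exp (t * wd x)) D]
  exact congrArg₂ (· * ·) (Finset.prod_congr rfl fun x _ => sum_blockWeight_erase_empty (a' K x) (g' K) (Real.exp (t * wd x)) _)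
    (Finset.prod_congr rfl fun x _ => if_pos rfl)

/-- **THE E2 DICTIONARY AT THE FINE LEVEL** [folklore]: run B's partition function on the refined lattice is the sum of its class values over run A's classes
(`T4MatchingAssembly.sum_classVal`: partial summation loses nothing). -/
theorem sum_classVal_decimated (K : ℕ) (t : ℝ) :
    ∑ D ∈ (Finset.univ : Finset α).powerset,
        classVal (fun _ => (Finset.univ : Finset (α → Finset (Fin m)))) (fun _ f => Finset.univ.filter fun x => (f x).Nonempty)
          (fun K t f => ∏ x, if f x = ∅ then g' K ^ m * Real.exp (t * w0) else a' K x ^ (f x).card * g' K ^ (m - (f x).card) * Real.exp (t * wd x)) K t D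
      = ∑ f : α → Finset (Fin m), ∏ x, if f x = ∅ then g' K ^ m * Real.exp (t * w0) else a' K x ^ (f x).card * g' K ^ (m - (f x).card) * Real.exp (t * wd x) :=
  sum_classVal (T := fun _ => (Finset.univ : Finset α).powerset) (fun _ _ => Finset.mem_powerset.mpr (Finset.subset_univ _)) t

end ClassValues

/-! ## §3 `Core` and `HybridNE7` for the decimated pair, by p587708 at the decimated letters -/

section Matching

variable (n : ℕ) {l₀ vol w0 B₀ : ℝ} {wd : α → ℝ} {a a' : ℕ → α → ℝ} {g g' p ε : ℕ → ℝ}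

/-- The decimated activity is positive (`a′ > 0`, `g′ > 0`, `m ≠ 0`). [folklore] -/
theorem decimatedActivity_pos (hm : m ≠ 0) {A G : ℝ} (hA : 0 < A) (hG : 0 < G) : 0 < (A + G) ^ m - G ^ m :=
  sub_pos.mpr (pow_lt_pow_left₀ (by linarith) hG.le hm)

/-- **★★ `Spine.NE7.Core` FOR THE DECIMATED PAIR** [folklore ∘ p587708 `core_defectGas` BY NAME].  Run A = the coarse ideal defect gas (`a_K`, `g_K`); run B = the refined one
(`a′_K`, `g′_K`, `m ≠ 0` fine sites per block) SUMMED INTO RUN A's CLASSES ALONG THE BLOCK SHADOW (`classVal`, node U5d); good classes `|D| ≤ n`.  If run A's letters are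
`e^{±ε_K}`-close PER DEFECT to the DECIMATED letters — `|log((a′_K(x) + g′_K)^m − g′_K^m) − log a_K(x) − (log g′_K^m − log g_K)| ≤ ε_K` — then `Core` holds with the remainder
`n·ε_K∕vol` and ONE extensive constant `|α|·(log g′_K^m − log g_K)` for every good class. -/
theorem core_decimatedGas (hm : m ≠ 0) (hvol : 0 < vol) (hg : ∀ K, 0 < g K) (hg' : ∀ K, 0 < g' K) (ha : ∀ K x, 0 < a K x) (ha' : ∀ K x, 0 < a' K x)
    (hε0 : ∀ K, 0 ≤ ε K)
    (hε : ∀ K x, |(Real.log ((a' K x + g' K) ^ m - g' K ^ m) - Real.log (a K x)) - (Real.log (g' K ^ m) - Real.log (g K))| ≤ ε K) :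
    Core l₀ vol (fun _ => (Finset.univ : Finset α).powerset) (fun _ _ => (Finset.univ : Finset α).powerset.filter fun D => n < D.card)
      (fun K t D => (∏ x ∈ D, a K x * Real.exp (t * wd x)) * ∏ _x ∈ Finset.univ \ D, g K * Real.exp (t * w0))
      (classVal (fun _ => (Finset.univ : Finset (α → Finset (Fin m)))) (fun _ f => Finset.univ.filter fun x => (f x).Nonempty)
        (fun K t f => ∏ x, if f x = ∅ then g' K ^ m * Real.exp (t * w0) else a' K x ^ (f x).card * g' K ^ (m - (f x).card) * Real.exp (t * wd x)))
      fun K => n * ε K / vol := by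
  have e : classVal (fun _ => (Finset.univ : Finset (α → Finset (Fin m)))) (fun _ f => Finset.univ.filter fun x => (f x).Nonempty)
        (fun K t f => ∏ x, if f x = ∅ then g' K ^ m * Real.exp (t * w0) else a' K x ^ (f x).card * g' K ^ (m - (f x).card) * Real.exp (t * wd x))
      = fun K t D => (∏ x ∈ D, ((a' K x + g' K) ^ m - g' K ^ m) * Real.exp (t * wd x)) * ∏ _x ∈ Finset.univ \ D, g' K ^ m * Real.exp (t * w0) :=
    funext fun K => funext fun t => funext fun D => classVal_decimated a' g' w0 wd K t D
  rw [e]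
  exact core_defectGas Finset.univ n (a' := fun K x => (a' K x + g' K) ^ m - g' K ^ m) (g' := fun K => g' K ^ m) hvol hg (fun K => pow_pos (hg' K) m)
    (fun K x _ => ha K x) (fun K x _ => decimatedActivity_pos hm (ha' K x) (hg' K)) hε0 fun K x _ => hε K x

/-- **EXACT MATCHING WHEN RUN A IS THE DECIMATION OF RUN B** [folklore]: if run A's letters ARE the decimated letters up to one common factor per step (`a_K(x) = κ_K·â_K(x)`,
`g_K = κ_K·ĝ_K`, `κ_K > 0` — the same RG, a free overall normalisation), the per-defect discrepancy vanishes and `Core` holds with `δ = 0` and ALL classes good (`n := |α|` would do; here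
any `n`). -/
theorem core_decimatedGas_exact (hm : m ≠ 0) (hvol : 0 < vol) {κ : ℕ → ℝ} (hκ : ∀ K, 0 < κ K) (hg' : ∀ K, 0 < g' K) (ha' : ∀ K x, 0 < a' K x)
    (hRGa : ∀ K x, a K x = κ K * ((a' K x + g' K) ^ m - g' K ^ m)) (hRGg : ∀ K, g K = κ K * g' K ^ m) :
    Core l₀ vol (fun _ => (Finset.univ : Finset α).powerset) (fun _ _ => (Finset.univ : Finset α).powerset.filter fun D => n < D.card)
      (fun K t D => (∏ x ∈ D, a K x * Real.exp (t * wd x)) * ∏ _x ∈ Finset.univ \ D, g K * Real.exp (t * w0))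
      (classVal (fun _ => (Finset.univ : Finset (α → Finset (Fin m)))) (fun _ f => Finset.univ.filter fun x => (f x).Nonempty)
        (fun K t f => ∏ x, if f x = ∅ then g' K ^ m * Real.exp (t * w0) else a' K x ^ (f x).card * g' K ^ (m - (f x).card) * Real.exp (t * wd x)))
      fun _ => 0 := by
  have h := core_decimatedGas (l₀ := l₀) (w0 := w0) (wd := wd) (a := a) (a' := a') (g := g) (g' := g') n hm hvol (ε := fun _ => 0)
    (fun K => by rw [hRGg K]; exact mul_pos (hκ K) (pow_pos (hg' K) m)) hg'
    (fun K x => by rw [hRGa K x]; exact mul_pos (hκ K) (decimatedActivity_pos hm (ha' K x) (hg' K))) ha' (fun _ => le_rfl)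
    (fun K x => by
      have hâ := decimatedActivity_pos hm (ha' K x) (hg' K)
      have hĝ : 0 < g' K ^ m := pow_pos (hg' K) m
      rw [hRGa K x, hRGg K, Real.log_mul (hκ K).ne' hâ.ne', Real.log_mul (hκ K).ne' hĝ.ne']
      simp)
  simpa only [mul_zero, zero_div] using h

/-- **★★ `HybridNE7` FOR THE DECIMATED PAIR IN THE FIBRED PRESENTATION** [folklore ∘ p587708 `hybridNE7_defectGas` BY NAME]: with the size cut `|D| > n`, defect densities
`a_K(x) ≤ p_K·g_K` (run A) and `(a′_K(x) + g′_K)^m − g′_K^m ≤ p_K·g′_K^m` (run B's BLOCK density), bounded observable letters `|w₀|, |w_d| ≤ B₀`, summable `ε`, and the displayed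
weight conditions, node U5's whole hybrid binder list holds for run A against THE CLASS VALUES OF RUN B — NE7b PRODUCED, shells zero. -/
theorem hybridNE7_decimatedGas (hm : m ≠ 0) (hvol : 0 < vol) (hg : ∀ K, 0 < g K) (hg' : ∀ K, 0 < g' K) (ha : ∀ K x, 0 < a K x) (ha' : ∀ K x, 0 < a' K x)
    (hp : ∀ K, 0 ≤ p K) (hap : ∀ K x, a K x ≤ p K * g K) (hâp : ∀ K x, (a' K x + g' K) ^ m - g' K ^ m ≤ p K * g' K ^ m)
    (hw0 : |w0| ≤ B₀) (hwd : ∀ x, |wd x| ≤ B₀) (hε0 : ∀ K, 0 ≤ ε K) (hεs : Summable ε)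
    (hε : ∀ K x, |(Real.log ((a' K x + g' K) ^ m - g' K ^ m) - Real.log (a K x)) - (Real.log (g' K ^ m) - Real.log (g K))| ≤ ε K)
    (hW1 : ∀ K, (1 + p K * Real.exp (2 * (l₀ * B₀))) ^ (Finset.univ : Finset α).card - 1 < 1)
    (hWs : Summable fun K => (1 + p K * Real.exp (2 * (l₀ * B₀))) ^ (Finset.univ : Finset α).card - 1) :
    HybridNE7 l₀ vol (fun _ => (Finset.univ : Finset α).powerset)
      (fun K t D => (∏ x ∈ D, a K x * Real.exp (t * wd x)) * ∏ _x ∈ Finset.univ \ D, g K * Real.exp (t * w0))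
      (classVal (fun _ => (Finset.univ : Finset (α → Finset (Fin m)))) (fun _ f => Finset.univ.filter fun x => (f x).Nonempty)
        (fun K t f => ∏ x, if f x = ∅ then g' K ^ m * Real.exp (t * w0) else a' K x ^ (f x).card * g' K ^ (m - (f x).card) * Real.exp (t * wd x)))
      (fun _ _ => (Finset.univ : Finset α).powerset.filter fun D => n < D.card) (fun K => (1 + p K * Real.exp (2 * (l₀ * B₀))) ^ (Finset.univ : Finset α).card - 1)
      (fun _ _ _ => 0) (fun _ _ _ => 0) (fun _ => 0) fun K => n * ε K / vol := by
  have e : classVal (fun _ => (Finset.univ : Finset (α → Finset (Fin m)))) (fun _ f => Finset.univ.filter fun x => (f x).Nonempty)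
        (fun K t f => ∏ x, if f x = ∅ then g' K ^ m * Real.exp (t * w0) else a' K x ^ (f x).card * g' K ^ (m - (f x).card) * Real.exp (t * wd x))
      = fun K t D => (∏ x ∈ D, ((a' K x + g' K) ^ m - g' K ^ m) * Real.exp (t * wd x)) * ∏ _x ∈ Finset.univ \ D, g' K ^ m * Real.exp (t * w0) :=
    funext fun K => funext fun t => funext fun D => classVal_decimated a' g' w0 wd K t D
  rw [e]
  exact hybridNE7_defectGas Finset.univ n (a' := fun K x => (a' K x + g' K) ^ m - g' K ^ m) (g' := fun K => g' K ^ m) hvol hg (fun K => pow_pos (hg' K) m)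
    (fun K x _ => ha K x) (fun K x _ => decimatedActivity_pos hm (ha' K x) (hg' K)) hp (fun K x _ => hap K x) (fun K x _ => hâp K x) hw0 (fun x _ => hwd x)
    hε0 hεs (fun K x _ => hε K x) hW1 hWs

omit [Fintype α] in
/-- **★ THE CALCULUS FIRES: p587708's IDEAL-GAS `HybridNE7` RE-KEYED ALONG A BLOCK MAP OF THE COARSE LATTICE** [folklore ∘ p593255 `hybridNE7_image_foldBad` BY NAME].  For ANY
`b : α → β` the class map `D ↦ D.image b` merges large defect sets with small ones (unsaturated), so the bad-class slot is folded first: at the BLOCKED key `Λ.powerset.image (·.image b)`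
the two runs' re-keyed families `classVal` carry `HybridNE7` with every class good, weight `0`, the re-keyed large-set terms as SHELLS (shell weight `W_K = (1 + p_K e^{2l₀B₀})^{|Λ|} − 1`),
and the SAME remainder `n·ε_K∕vol` — hypotheses verbatim those of p587708 `hybridNE7_defectGas`. -/
theorem hybridNE7_defectGas_blocked {β : Type*} [DecidableEq β] (Λ : Finset α) (b : α → β) (hvol : 0 < vol) (hg : ∀ K, 0 < g K) (hg' : ∀ K, 0 < g' K)
    (ha : ∀ K, ∀ x ∈ Λ, 0 < a K x) (ha' : ∀ K, ∀ x ∈ Λ, 0 < a' K x) (hp : ∀ K, 0 ≤ p K) (hap : ∀ K, ∀ x ∈ Λ, a K x ≤ p K * g K) (ha'p : ∀ K, ∀ x ∈ Λ, a' K x ≤ p K * g' K)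
    (hw0 : |w0| ≤ B₀) (hwd : ∀ x ∈ Λ, |wd x| ≤ B₀) (hε0 : ∀ K, 0 ≤ ε K) (hεs : Summable ε)
    (hε : ∀ K, ∀ x ∈ Λ, |(Real.log (a' K x) - Real.log (a K x)) - (Real.log (g' K) - Real.log (g K))| ≤ ε K)
    (hW1 : ∀ K, (1 + p K * Real.exp (2 * (l₀ * B₀))) ^ Λ.card - 1 < 1) (hWs : Summable fun K => (1 + p K * Real.exp (2 * (l₀ * B₀))) ^ Λ.card - 1) :
    HybridNE7 l₀ vol (fun _ => Λ.powerset.image fun D => D.image b)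
      (classVal (fun _ => Λ.powerset) (fun _ D => D.image b) fun K t D => (∏ x ∈ D, a K x * Real.exp (t * wd x)) * ∏ _x ∈ Λ \ D, g K * Real.exp (t * w0))
      (classVal (fun _ => Λ.powerset) (fun _ D => D.image b) fun K t D => (∏ x ∈ D, a' K x * Real.exp (t * wd x)) * ∏ _x ∈ Λ \ D, g' K * Real.exp (t * w0))
      (fun _ _ => ∅) (fun _ => 0)
      (classVal (fun _ => Λ.powerset) (fun _ D => D.image b) fun K t D =>
        if D ∈ Λ.powerset.filter (fun D => n < D.card) then (∏ x ∈ D, a K x * Real.exp (t * wd x)) * ∏ _x ∈ Λ \ D, g K * Real.exp (t * w0) else 0)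
      (classVal (fun _ => Λ.powerset) (fun _ D => D.image b) fun K t D =>
        if D ∈ Λ.powerset.filter (fun D => n < D.card) then (∏ x ∈ D, a' K x * Real.exp (t * wd x)) * ∏ _x ∈ Λ \ D, g' K * Real.exp (t * w0) else 0)
      (fun K => (1 + p K * Real.exp (2 * (l₀ * B₀))) ^ Λ.card - 1 + 0) fun K => n * ε K / vol :=
  N19RekeyingCalculus.hybridNE7_image_foldBad (hybridNE7_defectGas Λ n hvol hg hg' ha ha' hp hap ha'p hw0 hwd hε0 hεs hε hW1 hWs)

end Matching

/-! ## §5 Sanity (kernel): the closed form on the smallest refinement -/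

/-- SANITY: one block (`α = Unit`), two fine sites (`m = 2`), `a′ = g′ = 1`, no dressing: run B's class value at the defective class `{()}` is `(1 + 1)² − 1² = 3`
(the three non-empty fine defect sets), by `classVal_decimated`. [folklore] -/
example (K : ℕ) :
    classVal (fun _ => (Finset.univ : Finset (Unit → Finset (Fin 2)))) (fun _ f => Finset.univ.filter fun x => (f x).Nonempty)
        (fun K t f => ∏ x, if f x = ∅ then (fun _ => (1 : ℝ)) K ^ 2 * Real.exp (t * 0) else
          (fun _ _ => (1 : ℝ)) K x ^ (f x).card * (fun _ => (1 : ℝ)) K ^ (2 - (f x).card) * Real.exp (t * (fun _ => (0 : ℝ)) x)) K 0 {()} = 3 := by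
  rw [classVal_decimated]
  norm_num

end Summit.QuantumFields.YangMills.BalabanUVNodes.N19DecimatedDefectGas

end
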